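import Literature.AlgebraicGeometry.Motives.ZariskiSheavesOnAffineSchemes
import Mathlib.CategoryTheory.Functor.ReflectsIso.Basic
import Mathlib.CategoryTheory.Subfunctor.Basic
import Mathlib.AlgebraicGeometry.Cover.Open
import HarnessLib

/-!
# Morphisms and sections of Zariski sheaves are determined on affine schemes

Topic: `Literature/AlgebraicGeometry/Motives`. Consequences of the big Zariski comparison lemma
`isEquivalence_sheafPushforwardContinuous_Spec` (Görtz–Wedhorn, *Algebraic Geometry I*,
Exercise 8.1) for `Type u`-valued Zariski sheaves `F, G` on `Scheme.{u}`:

* `isIso_of_isIso_app_Spec`, `isIso_of_bijective_app_Spec` — a morphism `φ : F ⟶ G` that is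
  bijective on every affine scheme `Spec A` is an isomorphism (equivalences reflect
  isomorphisms).
* `hom_ext_of_app_Spec` — two morphisms agreeing on every `Spec A` are equal (faithfulness).
* `sections_ext_of_openCover` — two sections of `F` over `T` agreeing on the members of an open
  cover of `T` are equal (separation; in particular sections are determined on affine opens).
* `isSheaf_toFunctor_of_openCondition` — a subfunctor of a Zariski sheaf cut out by an OPEN
  CONDITION (as in `OpenSubfunctorCover`) is itself a Zariski sheaf.

## Sources

* U. Görtz, T. Wedhorn, *Algebraic Geometry I* (2nd ed. 2020), Ch. 8, (8.3) and Exercise 8.1.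
-/

namespace Literature.AlgebraicGeometry.Motives

universe u

open CategoryTheory CategoryTheory.Limits Opposite _root_.AlgebraicGeometry

variable {F G : Sheaf Scheme.zariskiTopology.{u} (Type u)}

/-- **A morphism of Zariski sheaves on `Sch` which is an isomorphism on every affine scheme is
an isomorphism** (Görtz–Wedhorn Exercise 8.1: restriction to `(Aff)` is an equivalence, hence
reflects isomorphisms). [cite: GortzWedhorn2020, Ch. 8 Exercise 8.1] -/
theorem isIso_of_isIso_app_Spec (φ : F ⟶ G)
    (h : ∀ A : CommRingCat.{u}, IsIso (φ.hom.app (op (Spec A)))) : IsIso φ := by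
  haveI := isEquivalence_sheafPushforwardContinuous_Spec.{u}
  set R := Scheme.Spec.sheafPushforwardContinuous (Type u)
    (Scheme.Spec.inducedTopology Scheme.zariskiTopology.{u}) Scheme.zariskiTopology.{u} with hR
  have hRφ : IsIso (R.map φ) := by
    rw [← ObjectProperty.isIso_hom_iff, NatTrans.isIso_iff_isIso_app]
    rintro ⟨A⟩
    exact h A.unop
  exact isIso_of_reflects_iso φ R

/-- **A morphism of Zariski sheaves on `Sch` which is bijective on every affine scheme is an
isomorphism.** [cite: GortzWedhorn2020, Ch. 8 Exercise 8.1] -/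
theorem isIso_of_bijective_app_Spec (φ : F ⟶ G)
    (h : ∀ A : CommRingCat.{u}, Function.Bijective (φ.hom.app (op (Spec A)))) : IsIso φ :=
  isIso_of_isIso_app_Spec φ fun A => (isIso_iff_bijective _).mpr (h A)

/-- **Morphisms of Zariski sheaves on `Sch` are determined on affine schemes**: if `φ, ψ : F ⟶ G`
agree on every `Spec A`, then `φ = ψ` (restriction to `(Aff)` is faithful).
[cite: GortzWedhorn2020, Ch. 8 Exercise 8.1] -/
theorem hom_ext_of_app_Spec (φ ψ : F ⟶ G)
    (h : ∀ A : CommRingCat.{u}, φ.hom.app (op (Spec A)) = ψ.hom.app (op (Spec A))) : φ = ψ := by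
  haveI := isEquivalence_sheafPushforwardContinuous_Spec.{u}
  set R := Scheme.Spec.sheafPushforwardContinuous (Type u)
    (Scheme.Spec.inducedTopology Scheme.zariskiTopology.{u}) Scheme.zariskiTopology.{u} with hR
  apply R.map_injective
  refine Sheaf.hom_ext (NatTrans.ext (funext fun A => ?_))
  exact h A.unop.unop

/-- **Sections of a Zariski sheaf are determined on an open cover**: two sections over `T` with
the same restrictions to every member of an open cover `𝒰` of `T` coincide (the separation half
of the sheaf axiom (Sh)). [cite: GortzWedhorn2020, Ch. 8 (8.3)] -/
theorem sections_ext_of_openCover {T : Scheme.{u}} (𝒰 : T.OpenCover) {s t : F.obj.obj (op T)}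
    (h : ∀ i, F.obj.map (𝒰.f i).op s = F.obj.map (𝒰.f i).op t) : s = t := by
  have hsep := ((isSheaf_iff_isSheaf_of_type _ _).mp F.property _
    𝒰.mem_grothendieckTopology).isSeparatedFor
  refine hsep.ext ?_
  rintro Y f ⟨Z, a, b, ⟨i⟩, rfl⟩
  rw [op_comp, F.obj.map_comp]
  simp only [types_comp_apply, h i]

/-! ## Open-condition subfunctors of sheaves are sheaves -/

/-- **A subfunctor of a Zariski sheaf cut out by an open condition is a Zariski sheaf**: if
`P ⊆ F` is a subfunctor such that for every `x ∈ F(T)` there is an open `U_x ⊆ T` with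
`h^*x ∈ P(T′) ↔ h(T′) ⊆ U_x` for all `h : T′ → T`, then `P` is a sheaf (glue in `F`; the glued
section lies in `P` because the covering family exhausts `T`, so `U_x = T`). Together with
`isIso_of_bijective_app_Spec` this identifies an open-condition subfunctor with any Zariski sheaf
mapping to it bijectively on affines. [cite: GortzWedhorn2020, Ch. 8 (8.3)] -/
theorem isSheaf_toFunctor_of_openCondition {F' : Scheme.{u}ᵒᵖ ⥤ Type u}
    (hF' : Presheaf.IsSheaf Scheme.zariskiTopology F') (P : Subfunctor F')
    (U : ∀ {T : Scheme.{u}}, F'.obj (op T) → T.Opens)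
    (hU : ∀ {T T' : Scheme.{u}} (x : F'.obj (op T)) (h : T' ⟶ T),
      F'.map h.op x ∈ P.obj (op T') ↔ Set.range h ⊆ (U x : Set T)) :
    Presheaf.IsSheaf Scheme.zariskiTopology P.toFunctor := by
  rw [isSheaf_iff_isSheaf_of_type] at hF' ⊢
  intro T S hS x hx
  -- glue the underlying family in `F'`
  obtain ⟨t, ht, huniq⟩ := hF' S hS (x.map P.ι) (hx.map P.ι)
  -- the glued section lies in `P`: the covering family exhausts `T`
  have htP : t ∈ P.obj (op T) := by
    obtain ⟨𝒰, h𝒰⟩ := Scheme.exists_cover_of_mem_grothendieckTopology hS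
    have hcov : ∀ p : T, p ∈ (U t : Set T) := by
      intro p
      obtain ⟨i, q, hq⟩ := 𝒰.exists_eq p
      have hi : S (𝒰.f i) := h𝒰 _ (𝒰.f i) (Presieve.ofArrows.mk i)
      have hmem : F'.map (𝒰.f i).op t ∈ P.obj (op (𝒰.X i)) := by
        rw [ht _ hi, Presieve.FamilyOfElements.map_apply]
        exact (x (𝒰.f i) hi).2
      exact (hU t (𝒰.f i)).mp hmem ⟨q, hq⟩
    have h1 := (hU t (𝟙 T)).mpr (fun p _ => hcov p)
    simpa using h1
  refine ⟨⟨t, htP⟩, ?_, ?_⟩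
  · exact Presieve.FamilyOfElements.IsAmalgamation.of_mono P.ι ht
  · intro t' ht'
    exact Subtype.ext (huniq t'.1 (ht'.map P.ι))

end Literature.AlgebraicGeometry.Motives
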